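import Mathlib
import HarnessLib

/-!
# Route `ThermalWedge`, item `stmt-HubbardSuperconductivity-1702` (`TwPureThermalBound`):
# the abstract real analysis of the thermodynamic limit of sector energies — part A (Fekete along squares)

Support file (`--supports stmt-HubbardSuperconductivity-1702`; pure real analysis, no definition, no
project import). **Fekete's lemma along squares with tiling and filling costs.** A sequence
`a : ℕ → ℝ` (think: the ground-state energy of the `L × L` torus in the sector `⌊νL²⌋`) with
* a volume lower bound `a(L) ≥ −cL²`,
* TILING `a(mM) ≤ m² a(M) + A m² M` (`m ≥ 1`, `M ≥ M₀`): `m²` blocks of side `M`, boundary cost `O(M)` per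
  block, and
* FILLING `a(kM + r) ≤ a(kM) + B (kM + r)(2M + 3)` (`k ≥ 1`, `r < M`, `M ≥ M₀`): the corner square of
  side `kM` inside the square of side `kM + r`, the complement filled at cost `O(L·M)`,
has a limiting density: `a(L)/L² → β := inf_{M ≥ M₀} (a(M)/M² + A/M)` (`ptb_tendsto_density_of_tiling`).
Proof (Ruelle, *Statistical Mechanics* (1969) §2.2, adapted to volume-type filling costs): tiling gives
`a(kM)/(kM)² ≤ a(M)/M² + A/M`, so `a(L)/L² + A/L ≥ β` is the lower half; for the upper half pick `M`
with `a(M)/M² + A/M < β + ε/2` and write `L = kM + r`: `a(L)/L² ≤ (kM/L)²·a(kM)/(kM)² + B(2M+3)/L`,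
and `(kM/L)² x ≤ x + 2cM/L` for `x = a(kM)/(kM)² ∈ [−c, β + ε/2)` because `1 − M/L ≤ kM/L ≤ 1`.
-/

set_option linter.dupNamespace false

noncomputable section

namespace Summit.HubbardSuperconductivity.HubbardSuperconductivity.Theorems

open Filter Set
open scoped Topology

/-- Tiling in density form: `a(kM)/(kM)² ≤ a(M)/M² + A/M` for `k ≥ 1`. [folklore] -/
theorem ptb_density_mul_le {a : ℕ → ℝ} {A : ℝ} {M₀ : ℕ} (hM₀ : 1 ≤ M₀)
    (htile : ∀ m M : ℕ, 1 ≤ m → M₀ ≤ M → a (m * M) ≤ (m : ℝ) ^ 2 * a M + A * ((m : ℝ) ^ 2 * M))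
    {k M : ℕ} (hk : 1 ≤ k) (hM : M₀ ≤ M) :
    a (k * M) / (((k * M : ℕ) : ℝ)) ^ 2 ≤ a M / (M : ℝ) ^ 2 + A / M := by
  have hMpos : (0 : ℝ) < M := by exact_mod_cast lt_of_lt_of_le (Nat.lt_of_lt_of_le Nat.zero_lt_one hM₀) hM
  have hkpos : (0 : ℝ) < k := by exact_mod_cast hk
  have h := htile k M hk hM
  have hkM : (0 : ℝ) < (((k * M : ℕ) : ℝ)) ^ 2 := by push_cast; positivity
  rw [div_le_iff₀ hkM]
  push_cast
  have e : (a M / (M : ℝ) ^ 2 + A / M) * ((k : ℝ) * M) ^ 2 = (k : ℝ) ^ 2 * a M + A * ((k : ℝ) ^ 2 * M) := by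
    field_simp
  rw [e]
  exact h

/-- The limiting density candidate `β = inf_{M ≥ M₀} (a(M)/M² + A/M)` is a lower bound up to `A/L`:
`β ≤ a(L)/L² + A/L` for `L ≥ M₀`. [folklore] -/
theorem ptb_sInf_le_density_add {a : ℕ → ℝ} {A : ℝ} {M₀ L : ℕ} (hL : M₀ ≤ L) {c : ℝ}
    (hlow : ∀ L : ℕ, M₀ ≤ L → -c ≤ a L / (L : ℝ) ^ 2 + A / L) :
    sInf ((fun M : ℕ => a M / (M : ℝ) ^ 2 + A / M) '' {M | M₀ ≤ M}) ≤ a L / (L : ℝ) ^ 2 + A / L :=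
  csInf_le ⟨-c, by rintro _ ⟨M, hM, rfl⟩; exact hlow M hM⟩ ⟨L, hL, rfl⟩

/-- **Fekete along squares with tiling and filling costs.** See the module docstring. [folklore] -/
theorem ptb_tendsto_density_of_tiling {a : ℕ → ℝ} {c A B : ℝ} (hc : 0 ≤ c) (hA : 0 ≤ A) (hB : 0 ≤ B)
    {M₀ : ℕ} (hM₀ : 1 ≤ M₀)
    (hlow : ∀ L : ℕ, -(c * (L : ℝ) ^ 2) ≤ a L)
    (htile : ∀ m M : ℕ, 1 ≤ m → M₀ ≤ M → a (m * M) ≤ (m : ℝ) ^ 2 * a M + A * ((m : ℝ) ^ 2 * M))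
    (hfill : ∀ k M r : ℕ, 1 ≤ k → M₀ ≤ M → r < M →
      a (k * M + r) ≤ a (k * M) + B * (((k * M + r : ℕ) : ℝ) * (2 * M + 3))) :
    Tendsto (fun L : ℕ => a L / (L : ℝ) ^ 2) atTop
      (𝓝 (sInf ((fun M : ℕ => a M / (M : ℝ) ^ 2 + A / M) '' {M | M₀ ≤ M}))) := by
  set b : ℕ → ℝ := fun M => a M / (M : ℝ) ^ 2 with hb
  set S : Set ℝ := (fun M : ℕ => b M + A / M) '' {M | M₀ ≤ M} with hS
  set β : ℝ := sInf S with hβ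
  -- `b ≥ -c`
  have hblow : ∀ L : ℕ, 1 ≤ L → -c ≤ b L := by
    intro L hL
    have hLpos : (0 : ℝ) < L := by exact_mod_cast hL
    rw [hb]
    simp only
    rw [le_div_iff₀ (by positivity)]
    linarith [hlow L]
  have hlow' : ∀ L : ℕ, M₀ ≤ L → -c ≤ a L / (L : ℝ) ^ 2 + A / L := by
    intro L hL
    have h1 := hblow L (hM₀.trans hL)
    have h2 : 0 ≤ A / L := div_nonneg hA (Nat.cast_nonneg L)
    simp only [hb] at h1
    linarith
  have hSne : S.Nonempty := ⟨_, M₀, (le_refl M₀ : M₀ ∈ {M | M₀ ≤ M}), rfl⟩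
  have hSbdd : BddBelow S := ⟨-c, by rintro _ ⟨M, hM, rfl⟩; exact hlow' M hM⟩
  rw [Metric.tendsto_atTop]
  intro ε hε
  -- pick a good block size `M`
  obtain ⟨_, ⟨M, hM, rfl⟩, hMε⟩ := exists_lt_of_csInf_lt hSne (show β < β + ε / 2 by linarith)
  have hM1 : 1 ≤ M := hM₀.trans hM
  have hMpos : (0 : ℝ) < M := by exact_mod_cast hM1
  -- the `O(1/L)` error terms: `2cM/L + B(2M+3)/L + A/L < ε/2` for large `L`
  set D : ℝ := 2 * c * M + B * (2 * M + 3) + A with hD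
  have hD0 : 0 ≤ D := by positivity
  obtain ⟨N₁, hN₁⟩ := exists_nat_gt (2 * D / ε)
  refine ⟨max N₁ (max M 1) + 1, fun L hL => ?_⟩
  have hLN : N₁ < L := by omega
  have hLM : M ≤ L := by omega
  have hL1 : 1 ≤ L := by omega
  have hLpos : (0 : ℝ) < L := by exact_mod_cast hL1
  have hDL : D / L < ε / 2 := by
    rw [div_lt_iff₀ hLpos]
    have : 2 * D / ε < L := hN₁.trans (by exact_mod_cast hLN)
    rw [div_lt_iff₀ hε] at this
    linarith
  rw [Real.dist_eq, abs_lt]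
  constructor
  · -- lower half: `β ≤ b L + A/L`
    have h1 := ptb_sInf_le_density_add (a := a) (A := A) (le_trans hM hLM) hlow'
    have h2 : A / L ≤ D / L := by
      apply div_le_div_of_nonneg_right _ hLpos.le
      rw [hD]; nlinarith
    change β ≤ a L / (L : ℝ) ^ 2 + A / L at h1
    linarith
  · -- upper half: `L = kM + r`
    set k : ℕ := L / M with hk
    set r : ℕ := L % M with hr
    have hLkr : L = k * M + r := by rw [hk, hr, mul_comm]; exact (Nat.div_add_mod L M).symm
    have hrM : r < M := Nat.mod_lt L (by omega)
    have hk1 : 1 ≤ k := (Nat.one_le_div_iff (by omega)).2 hLM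
    have hkMpos : (0 : ℝ) < ((k * M : ℕ) : ℝ) := by
      have : 0 < k * M := Nat.mul_pos (by omega) (by omega)
      exact_mod_cast this
    -- `x = b(kM) ∈ [-c, b M + A/M]`
    have hx_up : b (k * M) ≤ b M + A / M := ptb_density_mul_le hM₀ htile hk1 hM
    have hx_low : -c ≤ b (k * M) := hblow (k * M) (Nat.mul_pos (by omega) (by omega))
    -- the filling estimate in density form
    have hfillL := hfill k M r hk1 hM hrM
    rw [← hLkr] at hfillL
    have hbL : b L ≤ b (k * M) * ((((k * M : ℕ) : ℝ)) / L) ^ 2 + B * (2 * M + 3) / L := by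
      have key : a L ≤ a (k * M) + B * ((L : ℝ) * (2 * M + 3)) := by exact_mod_cast hfillL
      have e1 : b (k * M) * ((((k * M : ℕ) : ℝ)) / (L : ℝ)) ^ 2 = a (k * M) / (L : ℝ) ^ 2 := by
        rw [hb]
        simp only
        field_simp
      have e2 : a (k * M) / (L : ℝ) ^ 2 + B * (2 * M + 3) / L = (a (k * M) + B * ((L : ℝ) * (2 * M + 3))) / (L : ℝ) ^ 2 := by
        field_simp
      rw [e1, e2]
      exact div_le_div_of_nonneg_right key (by positivity)
    -- `(kM/L)² x ≤ x + 2cM/L`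
    have hratio1 : (((k * M : ℕ) : ℝ)) / L ≤ 1 := by
      rw [div_le_one hLpos]; exact_mod_cast (hLkr ▸ Nat.le_add_right (k * M) r)
    have hratio0 : 1 - (M : ℝ) / L ≤ (((k * M : ℕ) : ℝ)) / L := by
      rw [sub_le_iff_le_add, ← add_div, le_div_iff₀ hLpos, one_mul]
      have : L ≤ k * M + M := by rw [hLkr]; omega
      exact_mod_cast this
    have hratio_nn : 0 ≤ (((k * M : ℕ) : ℝ)) / L := by positivity
    have hML : (M : ℝ) / L ≤ 1 := by rw [div_le_one hLpos]; exact_mod_cast hLM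
    have hML0 : 0 ≤ (M : ℝ) / L := by positivity
    have hsq : b (k * M) * ((((k * M : ℕ) : ℝ)) / L) ^ 2 ≤ b M + A / M + 2 * c * M / L := by
      have h2cM : 0 ≤ 2 * c * M / L := by positivity
      rcases le_or_gt 0 (b (k * M)) with hx0 | hx0
      · -- `x ≥ 0`: `(kM/L)² x ≤ x`
        have hle1 : ((((k * M : ℕ) : ℝ)) / L) ^ 2 ≤ 1 := pow_le_one₀ hratio_nn hratio1
        have h1 : b (k * M) * ((((k * M : ℕ) : ℝ)) / L) ^ 2 ≤ b (k * M) := mul_le_of_le_one_right hx0 hle1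
        linarith only [h1, hx_up, h2cM]
      · -- `x < 0`: `(kM/L)² ≥ (1 - M/L)² ≥ 1 - 2M/L`, so `(kM/L)² x ≤ x (1 - 2M/L) ≤ x + 2cM/L`
        have h0 : 0 ≤ 1 - (M : ℝ) / L := by linarith only [hML]
        have hsq1 : (1 - (M : ℝ) / L) ^ 2 ≤ ((((k * M : ℕ) : ℝ)) / L) ^ 2 := pow_le_pow_left₀ h0 hratio0 2
        have hsq2 : 1 - 2 * ((M : ℝ) / L) ≤ (1 - (M : ℝ) / L) ^ 2 := by nlinarith only [sq_nonneg ((M : ℝ) / L)]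
        have h3 : b (k * M) * ((((k * M : ℕ) : ℝ)) / L) ^ 2 ≤ b (k * M) * (1 - 2 * ((M : ℝ) / L)) :=
          mul_le_mul_of_nonpos_left (hsq2.trans hsq1) hx0.le
        have h4 : b (k * M) * (1 - 2 * ((M : ℝ) / L)) = b (k * M) + (-b (k * M)) * (2 * ((M : ℝ) / L)) := by ring
        have h5 : (-b (k * M)) * (2 * ((M : ℝ) / L)) ≤ c * (2 * ((M : ℝ) / L)) :=
          mul_le_mul_of_nonneg_right (by linarith only [hx_low]) (by positivity)
        have h6 : c * (2 * ((M : ℝ) / L)) = 2 * c * M / L := by ring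
        linarith only [h3, h4, h5, h6, hx_up]
    have hfin : b L < β + ε := by
      have h7 : 2 * c * M / L + B * (2 * M + 3) / L ≤ D / L := by
        rw [hD, ← add_div]
        apply div_le_div_of_nonneg_right _ hLpos.le
        linarith only [hA]
      have hMε' : b M + A / M < β + ε / 2 := hMε
      linarith only [hbL, hsq, h7, hMε', hDL]
    linarith only [hfin]

end Summit.HubbardSuperconductivity.HubbardSuperconductivity.Theorems

end
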